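import Summits.BirchSwinnertonDyer.BirchSwinnertonDyer.Theorems.ThetaPartnerAtTwoSignedTransportAtTwoResidualNaturality
import Summits.BirchSwinnertonDyer.BirchSwinnertonDyer.Theorems.ThetaPartnerAtTwoSignedTransportAtTwoResidualKummer
import Literature.NumberTheory.EllipticCurves.GreenbergSelmerDualDataExistsProofs
import Literature.NumberTheory.EllipticCurves.IwasawaDualModule
import Literature.NumberTheory.EllipticCurves.Kobayashi2003.SignedSelmer
import Mathlib.GroupTheory.Coset.Card
import Mathlib.Algebra.Group.Subgroup.Finite
import HarnessLib

/-!
# Stub `stub_primTowerGap` (S1) of line `norm-one-torus` of the crux `SignedMuSeedAtTwoPlus`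
# (stmt-BirchSwinnertonDyer-21438 = `stub_residualSeedAtTwo` of Kμ⁺ stmt-BirchSwinnertonDyer-20689 BY NAME,
# route `ResidualThetaTransportAtTwo`) — PROVED (width seat bsd-wall-rtt-p4-w3 g6; `--supports stmt-BirchSwinnertonDyer-21438`)

HONEST FRAMING. THEOREMS ONLY (no `def`, no named fact, no `sorry`); the file proves the registered stub S1 of
`Cruxes/SignedMuSeedAtTwoPlus/Lines/norm_one_torus.lean` (sha b593f1fbe717) with the line's local definitions
`primResidualPlus`, `residualConj`, `PrimCertificate` UNFOLDED verbatim (so that `exact primTowerGap` closes the stub inside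
the skeleton); the crux stays open (stubs S2 `stub_primToSel2`, S3 `stub_primCertificate`); BSD is not proved by any of this.

WHAT.
* `§1` `finite_of_card_kerPow_lt_two_pow` — the MEMBER-FREE TOWER-GAP LEMMA (pure algebra, any prime `p`): an additive
  subgroup `R` stable under an endomorphism `φ`, whose elements are `p`-power torsion and fixed by some `φ^{p^a}`, is the
  union of the kernels `R[T^i]` of the powers of `T = φ − 1` (local nilpotence, tree lemma
  `IwasawaDual.pow_mul_prime_pow_apply_eq_zero`); if ONE of them is small, `#R[T^q] < 2^q`, the chain
  `0 = R[T⁰] ≤ R[T¹] ≤ ⋯ ≤ R[T^q]` has an improper step (each proper step at least doubles the order), the chain is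
  stationary from there (`x ∈ R[T^{i+2}] ⇒ Tx ∈ R[T^{i+1}] = R[T^i] ⇒ x ∈ R[T^{i+1}]`), and `R = R[T^i] ⊆ R[T^q]` is finite
  (Fukuda's stabilisation / Washington §13.2, read for a discrete `p`-torsion `Γ`-module instead of its dual).
* `§2` `primTowerGap` — S1 VERBATIM: for the primitive residual signed-plus set
  `R = primResidualPlus W κ ⊆ H¹(ℚ_∞, W[2^∞][2])` (unramified at every odd place, residually trivial at `∞`, signed-plus
  at `2`) and `T = conj_γ − 1`, a certificate `#R[T^q] < 2^q` at one `q ≥ 1` forces `R` finite. The hypotheses of §1 are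
  discharged by: `R` is closed under `+,−,0` (three memberships of additive images in `AddSubgroup`s), `conj_γ`-stable
  (`conj_σ ∘ conj_γ = conj_{σγ}`, `conjH1_mul_holds`; `pushH1_conjH1`), killed by `2` (`nsmul_discreteH1_eq_zero_of_forall`),
  and every class is fixed by some `conj_{γ^{2^a}}` (`GreenbergSelmer.exists_conjH1_pow_prime_pow_eq`, open stabilisers of
  the points of `W[2^∞][2]` from `isOpen_stabilizer_point_holds`).

References: [Fukuda1994] Thm. 1; [Washington1997] §13.2; [GreenbergLNM1716] §1 (PDF p. 60); [GreenbergVatsal2000] §2 pp. 17, 21;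
[Kobayashi2003] Def. 1.1.
-/

set_option autoImplicit false
-- D-0017: single-problem summit, so `Summit.BirchSwinnertonDyer.BirchSwinnertonDyer.…` repeats a namespace BY DESIGN.
set_option linter.dupNamespace false

noncomputable section

open scoped Classical AddSubgroup

open WeierstrassCurve NumberField IsDedekindDomain Literature Literature.NumberTheory.EllipticCurves
  Literature.NumberTheory.GaloisRepresentations Literature.NumberTheory.EllipticCurves.GreenbergVatsal2000
  Literature.NumberTheory.EllipticCurves.Kobayashi2003 ZpExtension
  Literature.NumberTheory.EllipticCurves.GreenbergSelmer
  Summit.BirchSwinnertonDyer.BirchSwinnertonDyer.Theorems.SignedTransportAtTwo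

namespace Summit.BirchSwinnertonDyer.BirchSwinnertonDyer.Theorems.SignedMuAtTwo.NormOneTorus

universe u

/-! ## §1. The member-free tower-gap lemma -/

section TowerGap

variable {S : Type*} [AddCommGroup S]

/-- **Tower-gap lemma (discrete side).** Let `R ≤ S` be an additive subgroup stable under an endomorphism `φ` of `S`, every
element of which is `p`-power torsion and fixed by some power `φ^{p^a}`; put `T = φ − 1`. If for one exponent `q` the set
`R[T^q] = {c ∈ R | T^q c = 0}` is a finite set with FEWER than `2^q` elements, then `R` is finite (indeed `R = R[T^q]`):
`T` is locally nilpotent on `R` (`(φ − 1)^{k p^a} c = 0` when `φ^{p^a} c = c`, `p^k c = 0`), the chain `R[T^i]` at most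
doubles `q` times below `2^q` so it has an improper step, and an improper step propagates upwards.
[cite: Fukuda1994, Thm. 1] [cite: Washington1997, §13.2] -/
theorem finite_of_card_kerPow_lt_two_pow {p : ℕ} (hp : p.Prime) (R : AddSubgroup S) (φ : AddMonoid.End S)
    (hφ : ∀ r ∈ R, φ r ∈ R) (htor : ∀ r ∈ R, ∃ k : ℕ, p ^ k • r = 0)
    (hfix : ∀ r ∈ R, ∃ a : ℕ, (φ ^ p ^ a) r = r) {q : ℕ} (F : Finset S)
    (hF : ∀ c, c ∈ F ↔ c ∈ R ∧ ((φ - 1) ^ q) c = 0) (hcard : F.card < 2 ^ q) :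
    (R : Set S).Finite := by
  set T : AddMonoid.End S := φ - 1 with hT_def
  -- `T` and its powers preserve `R`
  have hT : ∀ r ∈ R, T r ∈ R := fun r hr ↦ by
    rw [hT_def, IwasawaDual.End_sub_apply, AddMonoid.End.coe_one, id]
    exact R.sub_mem (hφ r hr) hr
  -- the filtration `K i = R[T^i]`
  let K : ℕ → AddSubgroup S := fun i ↦
    { carrier := {c | c ∈ R ∧ (T ^ i) c = 0}
      add_mem' := fun {a b} ha hb ↦ ⟨R.add_mem ha.1 hb.1, by rw [map_add, ha.2, hb.2, add_zero]⟩
      zero_mem' := ⟨R.zero_mem, map_zero _⟩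
      neg_mem' := fun {a} ha ↦ ⟨R.neg_mem ha.1, by rw [map_neg, ha.2, neg_zero]⟩ }
  have memK : ∀ i c, c ∈ K i ↔ c ∈ R ∧ (T ^ i) c = 0 := fun _ _ ↦ Iff.rfl
  have hK0 : K 0 = ⊥ := by
    ext c
    rw [memK, pow_zero, AddMonoid.End.coe_one, id, AddSubgroup.mem_bot]
    exact ⟨fun h ↦ h.2, fun h ↦ ⟨h ▸ R.zero_mem, h⟩⟩
  have hmono : ∀ i, K i ≤ K (i + 1) := fun i c hc ↦
    ⟨hc.1, by rw [pow_succ', AddMonoid.End.coe_mul, Function.comp_apply, hc.2, map_zero]⟩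
  have hmono' : Monotone K := monotone_nat_of_le_succ hmono
  -- an improper step propagates
  have hprop : ∀ i, K i = K (i + 1) → K (i + 1) = K (i + 2) := by
    intro i h
    refine le_antisymm (hmono _) fun c hc ↦ ?_
    have hTc : T c ∈ K (i + 1) := by
      refine ⟨hT c hc.1, ?_⟩
      have h2 := hc.2
      rw [pow_succ, AddMonoid.End.coe_mul, Function.comp_apply] at h2
      exact h2
    rw [← h] at hTc
    refine ⟨hc.1, ?_⟩
    rw [pow_succ, AddMonoid.End.coe_mul, Function.comp_apply]
    exact hTc.2
  have hstat : ∀ i, K i = K (i + 1) → ∀ d, K (i + d) = K i := by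
    intro i h d
    induction d with
    | zero => rfl
    | succ d ih =>
      have step : ∀ e, K (i + e) = K (i + e + 1) := by
        intro e
        induction e with
        | zero => exact h
        | succ e ihe => exact hprop _ ihe
      rw [← ih, Nat.add_succ]
      exact (step d).symm
  -- `K q` is the given finite set
  have hKq : ((K q : AddSubgroup S) : Set S) = ↑F := by
    ext c
    rw [SetLike.mem_coe, memK, Finset.mem_coe, hF]
  have hKqfin : ((K q : AddSubgroup S) : Set S).Finite := by rw [hKq]; exact F.finite_toSet
  have hfinK : ∀ i, i ≤ q → Finite (K i) := fun i hi ↦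
    (hKqfin.subset (show ((K i : AddSubgroup S) : Set S) ⊆ K q from hmono' hi)).to_subtype
  have hcardq : Nat.card (K q) = F.card := by
    rw [← Nat.card_eq_finsetCard]
    exact Nat.card_congr (Equiv.setCongr hKq)
  -- `q` proper steps would force `2^q ≤ #K q`
  have hcount : ∀ i, i ≤ q → (∀ j, j < i → K j ≠ K (j + 1)) → 2 ^ i ≤ Nat.card (K i) := by
    intro i
    induction i with
    | zero =>
      intro _ _
      rw [hK0, AddSubgroup.card_bot, pow_zero]
    | succ i ih =>
      intro hi hne
      have h1 := ih (Nat.le_of_succ_le hi) fun j hj ↦ hne j (Nat.lt_succ_of_lt hj)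
      haveI := hfinK (i + 1) hi
      haveI := hfinK i (Nat.le_of_succ_le hi)
      have hdvd : Nat.card (K i) ∣ Nat.card (K (i + 1)) := AddSubgroup.card_dvd_of_le (hmono i)
      obtain ⟨m, hm⟩ := hdvd
      have hpos : 0 < Nat.card (K (i + 1)) := Nat.card_pos
      have hm1 : m ≠ 1 := by
        rintro rfl
        rw [mul_one] at hm
        exact hne i (Nat.lt_succ_self i) (AddSubgroup.eq_of_le_of_card_ge (hmono i) hm.le)
      have hm0 : m ≠ 0 := by
        rintro rfl
        rw [mul_zero] at hm
        omega
      have hm2 : 2 ≤ m := by omega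
      calc 2 ^ (i + 1) = 2 ^ i * 2 := pow_succ 2 i
        _ ≤ Nat.card (K i) * m := Nat.mul_le_mul h1 hm2
        _ = Nat.card (K (i + 1)) := hm.symm
  -- hence some step below `q` is improper
  have hex : ∃ j, j < q ∧ K j = K (j + 1) := by
    by_contra h
    push Not at h
    have h2 := hcount q le_rfl h
    rw [hcardq] at h2
    omega
  obtain ⟨j, hjq, hj⟩ := hex
  -- and `R ⊆ K q`
  refine hKqfin.subset fun r hr ↦ ?_
  obtain ⟨k, hk⟩ := htor r hr
  obtain ⟨a, ha⟩ := hfix r hr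
  have hnil : (T ^ (k * p ^ a)) r = 0 := IwasawaDual.pow_mul_prime_pow_apply_eq_zero hp φ a ha hk
  have hrn : r ∈ K (j + (k * p ^ a)) :=
    hmono' (Nat.le_add_left _ _) (show r ∈ K (k * p ^ a) from ⟨hr, hnil⟩)
  rw [hstat j hj] at hrn
  exact hmono' hjq.le hrn

end TowerGap

/-! ## §2. The registered stub S1 `stub_primTowerGap` of line `norm-one-torus` -/

section Stub

/-- `(conj_γ)^n = conj_{γ^n}` on `H¹(H, M)` (pointwise): `conj_1 = id`, `conj_{στ} = conj_σ ∘ conj_τ`.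
Serre, *Galois Cohomology*, I.§2.5. [folklore] -/
theorem conjH1_pow_apply {K : Type u} [Field K] (H : Subgroup (Field.absoluteGaloisGroup K)) [H.Normal]
    (M : Type u) [AddCommGroup M] [DistribMulAction (Field.absoluteGaloisGroup K) M] [TopologicalSpace M]
    [DiscreteTopology M] (γ : Field.absoluteGaloisGroup K) (n : ℕ) (c : subgroupH1 H M) :
    ((@id (AddMonoid.End (subgroupH1 H M)) (Literature.NumberTheory.EllipticCurves.conjH1 H M γ)) ^ n) c =
      Literature.NumberTheory.EllipticCurves.conjH1 H M (γ ^ n) c := by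
  induction n generalizing c with
  | zero =>
    rw [pow_zero, pow_zero, AddMonoid.End.coe_one, id, Literature.NumberTheory.EllipticCurves.conjH1_one_holds H M,
      AddMonoidHom.id_apply]
  | succ n ih =>
    rw [pow_succ, pow_succ, AddMonoid.End.coe_mul, Function.comp_apply,
      Literature.NumberTheory.EllipticCurves.conjH1_mul_holds H M, AddMonoidHom.comp_apply]
    exact ih _

/-- **S1 · primTowerGap** (= `stub_primTowerGap` of `Cruxes/SignedMuSeedAtTwoPlus/Lines/norm_one_torus.lean`, with the line's
local definitions `primResidualPlus`, `residualConj`, `PrimCertificate` unfolded verbatim). For the PRIMITIVE residual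
signed-plus set `R ⊆ H¹(ℚ_∞, W[2^∞][2])` — classes (a) unramified at every odd place, (b) residually trivial at `∞`,
(c) signed-plus at `2` — and `T = conj_γ − 1`: if for one `q ≥ 1` the `T^q`-torsion `R[T^q]` is a finite set of fewer than
`2^q` classes, then `R` is finite. `R` is an additive subgroup (three memberships of additive images in `AddSubgroup`s),
stable under `conj_γ` (`conj_σ ∘ conj_γ = conj_{σγ}`; `pushH1` commutes with conjugation), killed by `2` (cohomology of a
`2`-torsion module), and every class is fixed by some `conj_{γ^{2^a}}` (points of `W[2^∞][2]` have open stabilisers); so the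
tower-gap lemma `finite_of_card_kerPow_lt_two_pow` applies. (The hypotheses `κ.IsCyclotomic` and `1 ≤ q` of the registered
signature are not needed.) [cite: Fukuda1994, Thm. 1] [cite: GreenbergLNM1716, §1 (after Conj. 1.3)]
[cite: GreenbergVatsal2000, §2 pp. 17, 21] [cite: Kobayashi2003, Def. 1.1] -/
theorem primTowerGap :
    ∀ (W : WeierstrassCurve ℚ) [W.IsElliptic] (κ : ZpExtension ℚ 2) (γ : Field.absoluteGaloisGroup ℚ),
      κ.IsCyclotomic → κ.IsTopGenerator γ → ∀ q : ℕ, 1 ≤ q →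
      (∃ F : Finset (subgroupH1 κ.kerSubgroup ↥((↥(W.geomPrimaryTorsion 2))[(2 : ℤ)])),
        (∀ c, c ∈ F ↔ (c ∈
          {c : subgroupH1 κ.kerSubgroup ↥((↥(W.geomPrimaryTorsion 2))[(2 : ℤ)]) |
            c ∈ unramifiedOutside κ.kerSubgroup ↥((↥(W.geomPrimaryTorsion 2))[(2 : ℤ)]) 2
                  (∅ : Set (HeightOneSpectrum (𝓞 ℚ))) ∧
              (∀ (w : InfinitePlace ℚ) (σ : Field.absoluteGaloisGroup ℚ),
                Literature.NumberTheory.EllipticCurves.conjH1 κ.kerSubgroup ↥((↥(W.geomPrimaryTorsion 2))[(2 : ℤ)]) σ c ∈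
                  GreenbergSelmer.infKer κ.kerSubgroup ↥((↥(W.geomPrimaryTorsion 2))[(2 : ℤ)]) w) ∧
              (∀ (v : HeightOneSpectrum (𝓞 ℚ)), ((2 : ℕ) : 𝓞 ℚ) ∈ v.asIdeal → ∀ σ : Field.absoluteGaloisGroup ℚ,
                W.conjH1 2 κ.kerSubgroup σ
                    (pushH1 κ.kerSubgroup ((↥(W.geomPrimaryTorsion 2))[(2 : ℤ)]).subtype (subtype_torsionBy_smul W 2) c) ∈
                  localKummerOverOfEmb W 2 κ.kerSubgroup (closureEmb (K := ℚ) (v.adicCompletion ℚ))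
                    (⨆ n : ℕ, signedLocalPoints κ (v.adicCompletion ℚ) W 1 n))} ∧
          ((@HSub.hSub (AddMonoid.End (subgroupH1 κ.kerSubgroup ↥((↥(W.geomPrimaryTorsion 2))[(2 : ℤ)])))
              (AddMonoid.End (subgroupH1 κ.kerSubgroup ↥((↥(W.geomPrimaryTorsion 2))[(2 : ℤ)])))
              (AddMonoid.End (subgroupH1 κ.kerSubgroup ↥((↥(W.geomPrimaryTorsion 2))[(2 : ℤ)]))) instHSub
              (Literature.NumberTheory.EllipticCurves.conjH1 κ.kerSubgroup ↥((↥(W.geomPrimaryTorsion 2))[(2 : ℤ)]) γ) 1) ^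
            q) c = 0)) ∧
        F.card < 2 ^ q) →
      {c : subgroupH1 κ.kerSubgroup ↥((↥(W.geomPrimaryTorsion 2))[(2 : ℤ)]) |
        c ∈ unramifiedOutside κ.kerSubgroup ↥((↥(W.geomPrimaryTorsion 2))[(2 : ℤ)]) 2
              (∅ : Set (HeightOneSpectrum (𝓞 ℚ))) ∧
          (∀ (w : InfinitePlace ℚ) (σ : Field.absoluteGaloisGroup ℚ),
            Literature.NumberTheory.EllipticCurves.conjH1 κ.kerSubgroup ↥((↥(W.geomPrimaryTorsion 2))[(2 : ℤ)]) σ c ∈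
              GreenbergSelmer.infKer κ.kerSubgroup ↥((↥(W.geomPrimaryTorsion 2))[(2 : ℤ)]) w) ∧
          (∀ (v : HeightOneSpectrum (𝓞 ℚ)), ((2 : ℕ) : 𝓞 ℚ) ∈ v.asIdeal → ∀ σ : Field.absoluteGaloisGroup ℚ,
            W.conjH1 2 κ.kerSubgroup σ
                (pushH1 κ.kerSubgroup ((↥(W.geomPrimaryTorsion 2))[(2 : ℤ)]).subtype (subtype_torsionBy_smul W 2) c) ∈
              localKummerOverOfEmb W 2 κ.kerSubgroup (closureEmb (K := ℚ) (v.adicCompletion ℚ))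
                (⨆ n : ℕ, signedLocalPoints κ (v.adicCompletion ℚ) W 1 n))}.Finite := by
  intro W _ κ γ _hκ hγ q _hq hcert
  obtain ⟨F, hF, hcard⟩ := hcert
  -- notation
  let M : Type := ↥((↥(W.geomPrimaryTorsion 2))[(2 : ℤ)])
  let kW := pushH1 κ.kerSubgroup ((↥(W.geomPrimaryTorsion 2))[(2 : ℤ)]).subtype (subtype_torsionBy_smul W 2)
  -- conjugation commutes with the Kummer map
  have hconj : ∀ (σ : Field.absoluteGaloisGroup ℚ) (c : subgroupH1 κ.kerSubgroup M),
      W.conjH1 2 κ.kerSubgroup σ (kW c) =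
        kW (Literature.NumberTheory.EllipticCurves.conjH1 κ.kerSubgroup M σ c) :=
    fun σ c ↦ (pushH1_conjH1 κ.kerSubgroup ((↥(W.geomPrimaryTorsion 2))[(2 : ℤ)]).subtype
      (subtype_torsionBy_smul W 2) σ c).symm
  -- `conj_σ ∘ conj_γ = conj_{σγ}` on both cohomology groups
  have hmul : ∀ (σ τ : Field.absoluteGaloisGroup ℚ) (c : subgroupH1 κ.kerSubgroup M),
      Literature.NumberTheory.EllipticCurves.conjH1 κ.kerSubgroup M σ
          (Literature.NumberTheory.EllipticCurves.conjH1 κ.kerSubgroup M τ c) =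
        Literature.NumberTheory.EllipticCurves.conjH1 κ.kerSubgroup M (σ * τ) c := fun σ τ c ↦ by
    rw [Literature.NumberTheory.EllipticCurves.conjH1_mul_holds κ.kerSubgroup M, AddMonoidHom.comp_apply]
  have hmulW : ∀ (σ τ : Field.absoluteGaloisGroup ℚ) (c : W.subgroupH1 2 κ.kerSubgroup),
      W.conjH1 2 κ.kerSubgroup σ (W.conjH1 2 κ.kerSubgroup τ c) = W.conjH1 2 κ.kerSubgroup (σ * τ) c := fun σ τ c ↦ by
    rw [W.conjH1_mul_holds 2 κ.kerSubgroup, AddMonoidHom.comp_apply]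
  -- the primitive residual plus-set as an additive subgroup
  let R : AddSubgroup (subgroupH1 κ.kerSubgroup M) :=
    { carrier := {c : subgroupH1 κ.kerSubgroup M |
        c ∈ unramifiedOutside κ.kerSubgroup M 2 (∅ : Set (HeightOneSpectrum (𝓞 ℚ))) ∧
          (∀ (w : InfinitePlace ℚ) (σ : Field.absoluteGaloisGroup ℚ),
            Literature.NumberTheory.EllipticCurves.conjH1 κ.kerSubgroup M σ c ∈ GreenbergSelmer.infKer κ.kerSubgroup M w) ∧
          (∀ (v : HeightOneSpectrum (𝓞 ℚ)), ((2 : ℕ) : 𝓞 ℚ) ∈ v.asIdeal → ∀ σ : Field.absoluteGaloisGroup ℚ,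
            W.conjH1 2 κ.kerSubgroup σ (kW c) ∈
              localKummerOverOfEmb W 2 κ.kerSubgroup (closureEmb (K := ℚ) (v.adicCompletion ℚ))
                (⨆ n : ℕ, signedLocalPoints κ (v.adicCompletion ℚ) W 1 n))}
      add_mem' := fun {a b} ha hb ↦
        ⟨add_mem ha.1 hb.1,
          fun w σ ↦ by rw [map_add]; exact add_mem (ha.2.1 w σ) (hb.2.1 w σ),
          fun v hv σ ↦ by rw [map_add, map_add]; exact add_mem (ha.2.2 v hv σ) (hb.2.2 v hv σ)⟩
      zero_mem' :=
        ⟨zero_mem _, fun w σ ↦ by rw [map_zero]; exact zero_mem _,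
          fun v hv σ ↦ by rw [map_zero, map_zero]; exact zero_mem _⟩
      neg_mem' := fun {a} ha ↦
        ⟨neg_mem ha.1,
          fun w σ ↦ by rw [map_neg]; exact neg_mem (ha.2.1 w σ),
          fun v hv σ ↦ by rw [map_neg, map_neg]; exact neg_mem (ha.2.2 v hv σ)⟩ }
  -- `R` is `conj_γ`-stable
  have hφ : ∀ r ∈ R, Literature.NumberTheory.EllipticCurves.conjH1 κ.kerSubgroup M γ r ∈ R := by
    rintro r ⟨hra, hrb, hrc⟩
    refine ⟨?_, fun w σ ↦ ?_, fun v hv σ ↦ ?_⟩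
    · rw [mem_unramifiedOutside_iff] at hra ⊢
      intro v hvS hv2 σ
      rw [hmul]
      exact hra v hvS hv2 (σ * γ)
    · rw [hmul]
      exact hrb w (σ * γ)
    · rw [← hconj, hmulW]
      exact hrc v hv (σ * γ)
  -- `R` is killed by `2`
  have htor : ∀ r ∈ R, ∃ k : ℕ, 2 ^ k • r = 0 := fun r _ ↦
    ⟨1, by
      rw [pow_one]
      exact nsmul_discreteH1_eq_zero_of_forall (fun n : M ↦ AddSubgroup.torsionBy.nsmul n) r⟩
  -- every class is fixed by some `conj_{γ^{2^a}}` (open stabilisers of the points of `W[2^∞][2]`)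
  have hstab : ∀ m : M, IsOpen (MulAction.stabilizer (Field.absoluteGaloisGroup ℚ) m : Set (Field.absoluteGaloisGroup ℚ)) := by
    intro m
    have hm : (MulAction.stabilizer (Field.absoluteGaloisGroup ℚ) m : Set (Field.absoluteGaloisGroup ℚ)) =
        MulAction.stabilizer (Field.absoluteGaloisGroup ℚ) (((m : ↥(W.geomPrimaryTorsion 2)) : geomPoints W)) := by
      ext τ
      simp only [SetLike.mem_coe, MulAction.mem_stabilizer_iff]
      rw [Subtype.ext_iff, Subtype.ext_iff]
      rfl
    rw [hm]
    exact isOpen_stabilizer_point_holds W _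
  have hfix : ∀ r ∈ R, ∃ a : ℕ,
      ((@id (AddMonoid.End (subgroupH1 κ.kerSubgroup M)) (Literature.NumberTheory.EllipticCurves.conjH1 κ.kerSubgroup M γ)) ^
          2 ^ a) r = r := fun r _ ↦ by
    obtain ⟨a, ha⟩ := GreenbergSelmer.exists_conjH1_pow_prime_pow_eq κ M hstab hγ r
    exact ⟨a, by rw [conjH1_pow_apply]; exact ha⟩
  -- the tower-gap lemma
  exact finite_of_card_kerPow_lt_two_pow Nat.prime_two R
    (@id (AddMonoid.End (subgroupH1 κ.kerSubgroup M)) (Literature.NumberTheory.EllipticCurves.conjH1 κ.kerSubgroup M γ))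
    hφ htor hfix F hF hcard

end Stub

end Summit.BirchSwinnertonDyer.BirchSwinnertonDyer.Theorems.SignedMuAtTwo.NormOneTorus

end
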